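import Summits.BirchSwinnertonDyer.BirchSwinnertonDyer.Theorems.Rank2ObservatoryTamagawaIstarLevel
import HarnessLib

/-!
# BSD rank ≥ 2 observatory (`b2b-bsdr2`, cert-2 gen 11): EXACT local Tamagawa numbers for the
# Kodaira types `Iₙ*` (`n ≥ 1`) — part 3: the rule read on an INTEGER model along `p = πε`

HONEST FRAMING: per-curve certified theorems and census instruments; no claim on BSD in rank ≥ 2.

Theorems only (no named fact, no axiom).  Parts 1–2 (`Rank2ObservatoryTamagawaIstarLocal/Level`)
proved Tate's rule for `Iₙ*` over a Henselian DVR: in the round-`m` normal form, `[E(K) : E₀(K)] = 4`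
iff the exit quadratic (`Y² + A₃Y − A₆` for `n = 2m + 1`, `pX² + A₄X + A₆` for `n = 2m + 2`) has a
residue root, `= 2` iff not.  This file casts an integer Weierstrass model `M` (already translated
into the round-`m` normal form by an integer change of variables, as the certificate does) into a DVR
`R` with `p = π · ε`, `ε ∈ Rˣ` (the tree's dictionary `Rank2ObservatoryTateDeepEngine`:
`intCast_eq_of_pow_dvd`, `isUnit_intCast`, `not_pow_succ_dvd_intCast`, …) and proves the four
integer-side theorems the kernel certificate `TamZ` invokes:
* `index_Istar_odd_intCast_eq_four/two` (`p ∣ a₁`, `p ∥ a₂`, `p^{m+2} ∣ a₃`, `p^{m+3} ∣ a₄`,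
  `p^{2m+4} ∣ a₆`, `p ∤ A₃² + 4A₆`; a witness `w` with `p ∣ w² + A₃w − A₆`, resp. none among
  `w < p`);
* `index_Istar_even_intCast_eq_four/two` (`p^{m+3} ∣ a₃, a₄`, `p^{2m+5} ∣ a₆`,
  `p ∤ A₄² − 4A₂A₆`; a witness `w` with `p ∣ A₂w² + A₄w + A₆`, resp. none among `w < p`),
where `A₂ = a₂/p`, `A₃ = a₃/p^{m+2}`, `A₄ = a₄/p^{m+3}`, `A₆ = a₆/p^{2m+4}` resp. `a₆/p^{2m+5}`, and
`pⁿ ∥ Δ` supplies `Δ ≠ 0` in `R`.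
References: [Tate1975] J. Tate, LNM 476 (1975) §7; [Silverman1994] [SilvermanATAEC1994] J. H.
Silverman, GTM 151 (1994), IV.9.4 Step 7, Table 4.1.
-/

set_option linter.dupNamespace false
set_option autoImplicit false

noncomputable section

open scoped Classical

open Polynomial IsLocalRing WeierstrassCurve
  Literature.NumberTheory.EllipticCurves Literature.NumberTheory.EllipticCurves.LocalIndex
  Literature.NumberTheory.DiophantineGeometry Literature.NumberTheory.DiophantineGeometry.TateAlgorithm

namespace Summit.BirchSwinnertonDyer.BirchSwinnertonDyer.Rank2Observatory.Tam

section IntCast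

open Tate

variable {R : Type*} [CommRing R] [IsDomain R] [IsDiscreteValuationRing R]
  {K : Type*} [Field K] [Algebra R K] [IsFractionRing R K] {p : ℕ} {ε : R}

/-- The value of `(ε̄P̄)X² + (ε̄^{m+3}Ā)X + ε̄^{2m+5}B̄` at `ε̄^{m+2} w̄` is `ε̄^{2m+5} (Pw² + Aw + B)‾`.
[folklore] -/
theorem quadratic_even_residue_intCast (m : ℕ) (P A B w : ℤ) :
    residue R (ε ^ 1 * ((P : ℤ) : R)) * (residue R (w : R) * residue R ε ^ (m + 2)) ^ 2 +
        residue R (ε ^ (m + 3) * ((A : ℤ) : R)) * (residue R (w : R) * residue R ε ^ (m + 2)) +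
        residue R (ε ^ (2 * m + 5) * ((B : ℤ) : R)) =
      residue R ε ^ (2 * m + 5) * residue R (((P * w ^ 2 + A * w + B : ℤ)) : R) := by
  push_cast
  simp only [map_add, map_mul, map_pow, map_intCast]
  ring

/-- If every residue class is represented by an integer `k < p` and `Pk² + Ak + B ≢ 0 (mod p)` for
every `k < p`, then `(ε̄P̄)X² + (ε̄^{m+3}Ā)X + ε̄^{2m+5}B̄` has no root in the residue field. [folklore] -/
theorem no_root_even_of_forall_lt (hp : p.Prime) (hε : IsUnit ε)
    (hpε : (p : R) = uniformizer R * ε)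
    (hsurj : ∀ y : ResidueField R, ∃ k : ℕ, k < p ∧ residue R ((k : ℤ) : R) = y) (m : ℕ)
    {P A B : ℤ} (hno : ∀ k : ℕ, k < p → ¬ (p : ℤ) ∣ P * (k : ℤ) ^ 2 + A * k + B)
    (x : ResidueField R) :
    residue R (ε ^ 1 * ((P : ℤ) : R)) * x ^ 2 + residue R (ε ^ (m + 3) * ((A : ℤ) : R)) * x +
      residue R (ε ^ (2 * m + 5) * ((B : ℤ) : R)) ≠ 0 := by
  have hē : residue R ε ^ (m + 2) ≠ 0 := pow_ne_zero _ (residue_ne_zero_of_isUnit hε)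
  intro hx
  obtain ⟨k, hkp, hk⟩ := hsurj (x * (residue R ε ^ (m + 2))⁻¹)
  have hx' : x = residue R ((k : ℤ) : R) * residue R ε ^ (m + 2) := by
    rw [hk, inv_mul_cancel_right₀ hē]
  rw [hx', quadratic_even_residue_intCast] at hx
  exact mul_ne_zero (pow_ne_zero _ (residue_ne_zero_of_isUnit hε))
    (residue_intCast_ne_zero hp hpε (hno k hkp)) hx

/-- **`Iₙ*`, odd exit `n = 2m + 1`, a root ⟹ index `4`** on an integer equation (`R` Henselian).
[cite: Tate1975, §7] [cite: Silverman1994, IV.9.4 Step 7] -/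
theorem index_Istar_odd_intCast_eq_four [HenselianLocalRing R] (hp : p.Prime) (hε : IsUnit ε)
    (hpε : (p : R) = uniformizer R * ε) {M : WeierstrassCurve ℤ} {m : ℕ}
    (h1 : (p : ℤ) ^ 1 ∣ M.a₁) (h2 : (p : ℤ) ^ 1 ∣ M.a₂) (h2' : ¬ (p : ℤ) ^ (1 + 1) ∣ M.a₂)
    (h3 : (p : ℤ) ^ (m + 2) ∣ M.a₃) (h4 : (p : ℤ) ^ (m + 3) ∣ M.a₄)
    (h6 : (p : ℤ) ^ (2 * (m + 2)) ∣ M.a₆)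
    (hq : ¬ (p : ℤ) ∣ (M.a₃ / (p : ℤ) ^ (m + 2)) ^ 2 + 4 * (M.a₆ / (p : ℤ) ^ (2 * (m + 2))))
    {n : ℕ} (hΔ : (p : ℤ) ^ n ∣ M.Δ) (hΔ' : ¬ (p : ℤ) ^ (n + 1) ∣ M.Δ) {w : ℤ}
    (hw : (p : ℤ) ∣ w ^ 2 + M.a₃ / (p : ℤ) ^ (m + 2) * w - M.a₆ / (p : ℤ) ^ (2 * (m + 2))) :
    ((M.map (Int.castRingHom R)).nonsingularReductionSubgroup
      (integers_valuationRing_valuation R K)).index = 4 := by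
  obtain ⟨e1, e2, e3, e4, e6, eΔ⟩ := map_intCast_eqs (R := R) M
  refine index_Istar_odd_eq_four (K := K) _ (m := m)
    (α := ε ^ 1 * ((M.a₁ / (p : ℤ) ^ 1 : ℤ) : R)) (p := ε ^ 1 * ((M.a₂ / (p : ℤ) ^ 1 : ℤ) : R))
    (A₃ := ε ^ (m + 2) * ((M.a₃ / (p : ℤ) ^ (m + 2) : ℤ) : R))
    (A₄ := ε ^ (m + 3) * ((M.a₄ / (p : ℤ) ^ (m + 3) : ℤ) : R))
    (A₆ := ε ^ (2 * (m + 2)) * ((M.a₆ / (p : ℤ) ^ (2 * (m + 2)) : ℤ) : R))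
    (by rw [e1, intCast_eq_of_pow_dvd hpε h1, pow_one])
    (by rw [e2, intCast_eq_of_pow_dvd hpε h2, pow_one])
    ((hε.pow 1).mul (isUnit_intCast hp hpε (not_dvd_div_of_pexact h2 h2')))
    (by rw [e3, intCast_eq_of_pow_dvd hpε h3]) (by rw [e4, intCast_eq_of_pow_dvd hpε h4])
    (by rw [e6, intCast_eq_of_pow_dvd hpε h6]) ?_ ?_ (y₀ := ε ^ (m + 2) * (w : R)) ?_
  · rw [eΔ]; exact fun h0 => not_pow_succ_dvd_intCast hp hε hpε hΔ hΔ' (h0 ▸ dvd_zero _)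
  · have e : (ε ^ (m + 2) * ((M.a₃ / (p : ℤ) ^ (m + 2) : ℤ) : R)) ^ 2 +
        4 * (ε ^ (2 * (m + 2)) * ((M.a₆ / (p : ℤ) ^ (2 * (m + 2)) : ℤ) : R)) =
        ε ^ (2 * (m + 2)) * ((((M.a₃ / (p : ℤ) ^ (m + 2)) ^ 2 +
          4 * (M.a₆ / (p : ℤ) ^ (2 * (m + 2))) : ℤ)) : R) := by
      push_cast; ring
    rw [e]
    exact IsLocalRing.notMem_maximalIdeal.mpr ((hε.pow _).mul (isUnit_intCast hp hpε hq))
  · have e : (ε ^ (m + 2) * (w : R)) ^ 2 +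
        ε ^ (m + 2) * ((M.a₃ / (p : ℤ) ^ (m + 2) : ℤ) : R) * (ε ^ (m + 2) * (w : R)) -
        ε ^ (2 * (m + 2)) * ((M.a₆ / (p : ℤ) ^ (2 * (m + 2)) : ℤ) : R) =
        ε ^ (2 * (m + 2)) * (((w ^ 2 + M.a₃ / (p : ℤ) ^ (m + 2) * w -
          M.a₆ / (p : ℤ) ^ (2 * (m + 2)) : ℤ)) : R) := by
      push_cast; ring
    rw [e]
    exact Ideal.mul_mem_left _ _ (mem_maximalIdeal_iff_dvd.mpr
      (uniformizer_dvd_intCast hpε (by simpa only [pow_one] using hw)))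

/-- **`Iₙ*`, odd exit `n = 2m + 1`, no root ⟹ index `2`** on an integer equation (`R` Henselian,
every residue class represented by an integer `< p`). [cite: Tate1975, §7] [cite: Silverman1994, IV.9.4 Step 7] -/
theorem index_Istar_odd_intCast_eq_two [HenselianLocalRing R] (hp : p.Prime) (hε : IsUnit ε)
    (hpε : (p : R) = uniformizer R * ε) {M : WeierstrassCurve ℤ} {m : ℕ}
    (h1 : (p : ℤ) ^ 1 ∣ M.a₁) (h2 : (p : ℤ) ^ 1 ∣ M.a₂) (h2' : ¬ (p : ℤ) ^ (1 + 1) ∣ M.a₂)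
    (h3 : (p : ℤ) ^ (m + 2) ∣ M.a₃) (h4 : (p : ℤ) ^ (m + 3) ∣ M.a₄)
    (h6 : (p : ℤ) ^ (2 * (m + 2)) ∣ M.a₆)
    {n : ℕ} (hΔ : (p : ℤ) ^ n ∣ M.Δ) (hΔ' : ¬ (p : ℤ) ^ (n + 1) ∣ M.Δ)
    (hsurj : ∀ y : ResidueField R, ∃ k : ℕ, k < p ∧ residue R ((k : ℤ) : R) = y)
    (hno : ∀ k : ℕ, k < p →
      ¬ (p : ℤ) ∣ (k : ℤ) ^ 2 + M.a₃ / (p : ℤ) ^ (m + 2) * k - M.a₆ / (p : ℤ) ^ (2 * (m + 2))) :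
    ((M.map (Int.castRingHom R)).nonsingularReductionSubgroup
      (integers_valuationRing_valuation R K)).index = 2 := by
  obtain ⟨e1, e2, e3, e4, e6, eΔ⟩ := map_intCast_eqs (R := R) M
  refine index_Istar_odd_eq_two (K := K) _ (m := m)
    (α := ε ^ 1 * ((M.a₁ / (p : ℤ) ^ 1 : ℤ) : R)) (p := ε ^ 1 * ((M.a₂ / (p : ℤ) ^ 1 : ℤ) : R))
    (A₃ := ε ^ (m + 2) * ((M.a₃ / (p : ℤ) ^ (m + 2) : ℤ) : R))
    (A₄ := ε ^ (m + 3) * ((M.a₄ / (p : ℤ) ^ (m + 3) : ℤ) : R))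
    (A₆ := ε ^ (2 * (m + 2)) * ((M.a₆ / (p : ℤ) ^ (2 * (m + 2)) : ℤ) : R))
    (by rw [e1, intCast_eq_of_pow_dvd hpε h1, pow_one])
    (by rw [e2, intCast_eq_of_pow_dvd hpε h2, pow_one])
    ((hε.pow 1).mul (isUnit_intCast hp hpε (not_dvd_div_of_pexact h2 h2')))
    (by rw [e3, intCast_eq_of_pow_dvd hpε h3]) (by rw [e4, intCast_eq_of_pow_dvd hpε h4])
    (by rw [e6, intCast_eq_of_pow_dvd hpε h6]) ?_ (no_root_of_forall_lt hp hε hpε hsurj (m + 2) hno)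
  rw [eΔ]; exact fun h0 => not_pow_succ_dvd_intCast hp hε hpε hΔ hΔ' (h0 ▸ dvd_zero _)

/-- **`Iₙ*`, even exit `n = 2m + 2`, a root ⟹ index `4`** on an integer equation (`R` Henselian).
[cite: Tate1975, §7] [cite: Silverman1994, IV.9.4 Step 7] -/
theorem index_Istar_even_intCast_eq_four [HenselianLocalRing R] (hp : p.Prime) (hε : IsUnit ε)
    (hpε : (p : R) = uniformizer R * ε) {M : WeierstrassCurve ℤ} {m : ℕ}
    (h1 : (p : ℤ) ^ 1 ∣ M.a₁) (h2 : (p : ℤ) ^ 1 ∣ M.a₂) (h2' : ¬ (p : ℤ) ^ (1 + 1) ∣ M.a₂)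
    (h3 : (p : ℤ) ^ (m + 3) ∣ M.a₃) (h4 : (p : ℤ) ^ (m + 3) ∣ M.a₄)
    (h6 : (p : ℤ) ^ (2 * m + 5) ∣ M.a₆)
    (hq : ¬ (p : ℤ) ∣ (M.a₄ / (p : ℤ) ^ (m + 3)) ^ 2 -
      4 * (M.a₂ / (p : ℤ) ^ 1) * (M.a₆ / (p : ℤ) ^ (2 * m + 5)))
    {n : ℕ} (hΔ : (p : ℤ) ^ n ∣ M.Δ) (hΔ' : ¬ (p : ℤ) ^ (n + 1) ∣ M.Δ) {w : ℤ}
    (hw : (p : ℤ) ∣ M.a₂ / (p : ℤ) ^ 1 * w ^ 2 + M.a₄ / (p : ℤ) ^ (m + 3) * w +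
      M.a₆ / (p : ℤ) ^ (2 * m + 5)) :
    ((M.map (Int.castRingHom R)).nonsingularReductionSubgroup
      (integers_valuationRing_valuation R K)).index = 4 := by
  obtain ⟨e1, e2, e3, e4, e6, eΔ⟩ := map_intCast_eqs (R := R) M
  refine index_Istar_even_eq_four (K := K) _ (m := m)
    (α := ε ^ 1 * ((M.a₁ / (p : ℤ) ^ 1 : ℤ) : R)) (p := ε ^ 1 * ((M.a₂ / (p : ℤ) ^ 1 : ℤ) : R))
    (A₃ := ε ^ (m + 3) * ((M.a₃ / (p : ℤ) ^ (m + 3) : ℤ) : R))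
    (A₄ := ε ^ (m + 3) * ((M.a₄ / (p : ℤ) ^ (m + 3) : ℤ) : R))
    (A₆ := ε ^ (2 * m + 5) * ((M.a₆ / (p : ℤ) ^ (2 * m + 5) : ℤ) : R))
    (by rw [e1, intCast_eq_of_pow_dvd hpε h1, pow_one])
    (by rw [e2, intCast_eq_of_pow_dvd hpε h2, pow_one])
    ((hε.pow 1).mul (isUnit_intCast hp hpε (not_dvd_div_of_pexact h2 h2')))
    (by rw [e3, intCast_eq_of_pow_dvd hpε h3]) (by rw [e4, intCast_eq_of_pow_dvd hpε h4])
    (by rw [e6, intCast_eq_of_pow_dvd hpε h6]) ?_ ?_ (x₀ := ε ^ (m + 2) * (w : R)) ?_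
  · rw [eΔ]; exact fun h0 => not_pow_succ_dvd_intCast hp hε hpε hΔ hΔ' (h0 ▸ dvd_zero _)
  · have e : (ε ^ (m + 3) * ((M.a₄ / (p : ℤ) ^ (m + 3) : ℤ) : R)) ^ 2 -
        4 * (ε ^ 1 * ((M.a₂ / (p : ℤ) ^ 1 : ℤ) : R)) *
          (ε ^ (2 * m + 5) * ((M.a₆ / (p : ℤ) ^ (2 * m + 5) : ℤ) : R)) =
        ε ^ (2 * m + 6) * ((((M.a₄ / (p : ℤ) ^ (m + 3)) ^ 2 -
          4 * (M.a₂ / (p : ℤ) ^ 1) * (M.a₆ / (p : ℤ) ^ (2 * m + 5)) : ℤ)) : R) := by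
      push_cast; ring
    rw [e]
    exact IsLocalRing.notMem_maximalIdeal.mpr ((hε.pow _).mul (isUnit_intCast hp hpε hq))
  · have e : ε ^ 1 * ((M.a₂ / (p : ℤ) ^ 1 : ℤ) : R) * (ε ^ (m + 2) * (w : R)) ^ 2 +
        ε ^ (m + 3) * ((M.a₄ / (p : ℤ) ^ (m + 3) : ℤ) : R) * (ε ^ (m + 2) * (w : R)) +
        ε ^ (2 * m + 5) * ((M.a₆ / (p : ℤ) ^ (2 * m + 5) : ℤ) : R) =
        ε ^ (2 * m + 5) * (((M.a₂ / (p : ℤ) ^ 1 * w ^ 2 + M.a₄ / (p : ℤ) ^ (m + 3) * w +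
          M.a₆ / (p : ℤ) ^ (2 * m + 5) : ℤ)) : R) := by
      push_cast; ring
    rw [e]
    exact Ideal.mul_mem_left _ _ (mem_maximalIdeal_iff_dvd.mpr
      (uniformizer_dvd_intCast hpε (by simpa only [pow_one] using hw)))

/-- **`Iₙ*`, even exit `n = 2m + 2`, no root ⟹ index `2`** on an integer equation (`R` Henselian,
every residue class represented by an integer `< p`). [cite: Tate1975, §7] [cite: Silverman1994, IV.9.4 Step 7] -/
theorem index_Istar_even_intCast_eq_two [HenselianLocalRing R] (hp : p.Prime) (hε : IsUnit ε)
    (hpε : (p : R) = uniformizer R * ε) {M : WeierstrassCurve ℤ} {m : ℕ}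
    (h1 : (p : ℤ) ^ 1 ∣ M.a₁) (h2 : (p : ℤ) ^ 1 ∣ M.a₂) (h2' : ¬ (p : ℤ) ^ (1 + 1) ∣ M.a₂)
    (h3 : (p : ℤ) ^ (m + 3) ∣ M.a₃) (h4 : (p : ℤ) ^ (m + 3) ∣ M.a₄)
    (h6 : (p : ℤ) ^ (2 * m + 5) ∣ M.a₆)
    {n : ℕ} (hΔ : (p : ℤ) ^ n ∣ M.Δ) (hΔ' : ¬ (p : ℤ) ^ (n + 1) ∣ M.Δ)
    (hsurj : ∀ y : ResidueField R, ∃ k : ℕ, k < p ∧ residue R ((k : ℤ) : R) = y)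
    (hno : ∀ k : ℕ, k < p → ¬ (p : ℤ) ∣ M.a₂ / (p : ℤ) ^ 1 * (k : ℤ) ^ 2 +
      M.a₄ / (p : ℤ) ^ (m + 3) * k + M.a₆ / (p : ℤ) ^ (2 * m + 5)) :
    ((M.map (Int.castRingHom R)).nonsingularReductionSubgroup
      (integers_valuationRing_valuation R K)).index = 2 := by
  obtain ⟨e1, e2, e3, e4, e6, eΔ⟩ := map_intCast_eqs (R := R) M
  refine index_Istar_even_eq_two (K := K) _ (m := m)
    (α := ε ^ 1 * ((M.a₁ / (p : ℤ) ^ 1 : ℤ) : R)) (p := ε ^ 1 * ((M.a₂ / (p : ℤ) ^ 1 : ℤ) : R))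
    (A₃ := ε ^ (m + 3) * ((M.a₃ / (p : ℤ) ^ (m + 3) : ℤ) : R))
    (A₄ := ε ^ (m + 3) * ((M.a₄ / (p : ℤ) ^ (m + 3) : ℤ) : R))
    (A₆ := ε ^ (2 * m + 5) * ((M.a₆ / (p : ℤ) ^ (2 * m + 5) : ℤ) : R))
    (by rw [e1, intCast_eq_of_pow_dvd hpε h1, pow_one])
    (by rw [e2, intCast_eq_of_pow_dvd hpε h2, pow_one])
    ((hε.pow 1).mul (isUnit_intCast hp hpε (not_dvd_div_of_pexact h2 h2')))
    (by rw [e3, intCast_eq_of_pow_dvd hpε h3]) (by rw [e4, intCast_eq_of_pow_dvd hpε h4])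
    (by rw [e6, intCast_eq_of_pow_dvd hpε h6]) ?_
    (no_root_even_of_forall_lt hp hε hpε hsurj m hno)
  rw [eΔ]; exact fun h0 => not_pow_succ_dvd_intCast hp hε hpε hΔ hΔ' (h0 ▸ dvd_zero _)

end IntCast

end Summit.BirchSwinnertonDyer.BirchSwinnertonDyer.Rank2Observatory.Tam

end
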